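import Summits.QuantumFields.YangMills.Theorems.UnitScaleTiltProp7LinGaugeInvariance
import Summits.QuantumFields.YangMills.Theorems.UnitScaleTiltProp7PinnedRegaugeChartDivergenceHRK
import HarnessLib

/-!
# Prop 7, route-R E′, path (α′) — the `[F,ψ]` BOOKING of the (α′) knit: the door's linearised curvature of an infinitesimal gauge direction

Route `UnitScaleTilt`, crux K1 child «MinimiserStabilityRegPr» (`stmt-QuantumFields-19200`), cell ym3-torus, width seat px12 (gen 2).
THEOREMS ONLY (0 `def`, 0 `sorry`); `--supports stmt-QuantumFields-19200`, count-neutral.  YM₃ on T³ is a ladder rung (R3), not the Clay problem;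
nothing here claims the stub, the crux, d = 4 or the mass gap.

WHY.  In the (α′) knit ✓ `Prop7PV3EOfCorrectorRows.stub_PV3E_of_correctorRows` the corrector part of a competitor's chart is `A = D‴ − Z^ψ` with
`Z^ψ_b = ψ(b₋) − W_b·ψ(b₊)·W_b^*` the infinitesimal gauge direction of the PINNED corrector `ψ` (`ψ|_C = 0`), and the rows are booked against the
door's linearised-curvature energy `K_W(·) = Σ_p ‖ℒ_p(i·)‖²` (the four-term expression displayed in the knit) and the mass `ℓ⁻²Σ_b‖·‖²`.  The booking
`[F,ψ]` (namer ★p1 g14, 2026-08-28T19:14:09Z) is the row `K_W(Z^ψ) ≤ 4·Σ_p ‖W(∂p) − 1‖²·‖ψ(p₋)‖²`: on a gauge direction the four letters of `ℒ_p`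
TELESCOPE to the commutator with the plaquette variable, `ℒ_p(i·Z^ψ) = i·(ψ(x) − W(∂p)ψ(x)W(∂p)^*)` (`x = p.src`; ✓ `Prop7LinGaugeInvariance.linPart_gaugeDir_eq`
— the far corners cancel pairwise), and `‖X − PXP^*‖ ≤ 2‖P − 1‖·‖X‖`.  With the plaquette clause of (6)(e) (`‖W(∂p) − 1‖ ≤ a = e·ℓ⁻²`) this is
`≤ 4a²·Σ_p‖ψ(p₋)‖² ≤ 4a²d²·Σ_x‖ψ(x)‖²`, which the knit holder's pinned Poincaré turns into a `θ·ℓ⁻²Σ_b‖Z^ψ_b‖²` entry with `θ ∝ e²` and NO volume factor.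

WHAT IS PROVED (def-free; any `P`, level `i`, `SU(N)`; ns `…Theorems.Prop7GaugeDirPlaqK`).
* §1 `norm_sub_conj_le` (`‖X − PXP^*‖ ≤ 2‖P − 1‖‖X‖`, unitary `P`), `smul_linPart` (the four-term expression is `ℂ`-linear in the bond field).
* §2 ★ `linPlaq_gaugeDir_eq` — the door's `ℒ_p` (VERBATIM the knit's letters) at `D := Z^λ`: `ℒ_p(i·Z^λ) = i·(λ(x) − W(∂p)·λ(x)·W(∂p)^*)`;
  `gaugeDir_eq_neg_covD` — the same direction in the B9 letters of the S4 rows: `Z^λ_{(z,κ)} = −(D_{W,κ}λ)(z)` for `covD (torusT P i) (unitsField (toUField W))`;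
  ★ `norm_linPlaq_gaugeDir_le` — `‖ℒ_p(i·Z^λ)‖ ≤ 2·‖W(∂p) − 1‖·‖λ(p.src)‖`.
* §3 ★★ `plaqK_gaugeDir_le` — `K_W(Z^λ) ≤ 4·Σ_p ‖W(∂p) − 1‖²·‖λ(p.src)‖²` (any `W`, any site field `λ`);
  ★★★ `plaqK_gaugeDir_le_of_dist1_le` — under `dist1(W(∂p)) ≤ a`: `K_W(Z^λ) ≤ 4a²·Σ_p‖λ(p.src)‖²`, and `plaqK_gaugeDir_le_sites` — `≤ 4a²·d²·Σ_x‖λ(x)‖²`.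
HONEST SCOPE.  Exact algebra + two norm inequalities over landed bricks; the pinned Poincaré (`Σ_x‖ψ‖² ≤ C_Pℓ²Σ_b‖Z^ψ‖²`) and the insertion into
`hrowsU` are the knit holder's.  Constants ours.

References: T. Bałaban, CMP 99 (1985) 389–434 [Balaban1985BackgroundPropagators] ((3.3)–(3.4) pp.390–391, (3.9)–(3.11) p.392); CMP 102 (1985) 277–309
[Balaban1985Variational] ((6) p.278, (47)–(48) pp.285–286, (141)–(143) p.299); CMP 98 (1985) 17–51 [Balaban1985Averaging] ((19)–(21) p.21).
-/

set_option autoImplicit false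

noncomputable section

open scoped BigOperators Matrix.Norms.L2Operator Matrix

namespace Summit.QuantumFields.YangMills.Theorems.Prop7GaugeDirPlaqK

open Literature.MathematicalPhysics.QuantumFieldTheory.Balaban1983to89
open B9Eq39Adjoint (R covD)
open B10Eq27TorusAxialLog (unitsField toUField)
open B9TorusCalculus (torusT torusT_apply)
open Summit.QuantumFields.YangMills.Theorems.Prop7LinGaugeInvariance (linPart_gaugeDir_eq)
open Summit.QuantumFields.YangMills.Theorems.Prop7CovariantCoercivity (plaqHol_eq_word)
open Summit.QuantumFields.YangMills.Theorems.Prop7PinnedRegaugeChartDivergenceHRK (sum_plaq_le_sum_site_dir)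

/-! ## §1 Algebra -/

section Algebra

variable {n : Type*} [Fintype n] [DecidableEq n]

/-- `‖X − P·X·P^*‖ ≤ 2·‖P − 1‖·‖X‖` for unitary `P` (`X − PXP^* = (1 − P)XP^* + X(1 − P^*)`, `‖P^*‖ ≤ 1`). [folklore] [cite: Balaban1985Averaging, (19)-(21) p.21] -/
theorem norm_sub_conj_le {P : Matrix n n ℂ} (hP : P ∈ Matrix.unitaryGroup n ℂ) (X : Matrix n n ℂ) :
    ‖X - P * X * star P‖ ≤ 2 * ‖P - 1‖ * ‖X‖ := by
  have hid : X - P * X * star P = (1 - P) * X * star P + X * (1 - star P) := by noncomm_ring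
  rw [hid]
  have h1 : ‖(1 - P) * X * star P‖ ≤ ‖P - 1‖ * ‖X‖ := by
    calc ‖(1 - P) * X * star P‖ = ‖(1 - P) * X‖ := CStarRing.norm_mul_mem_unitary _ (Unitary.star_mem hP)
      _ ≤ ‖1 - P‖ * ‖X‖ := norm_mul_le _ _
      _ = ‖P - 1‖ * ‖X‖ := by rw [norm_sub_rev]
  have h2 : ‖X * (1 - star P)‖ ≤ ‖P - 1‖ * ‖X‖ := by
    have e : (1 : Matrix n n ℂ) - star P = star (1 - P) := by rw [star_sub, star_one]
    calc ‖X * (1 - star P)‖ ≤ ‖X‖ * ‖1 - star P‖ := norm_mul_le _ _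
      _ = ‖P - 1‖ * ‖X‖ := by rw [e, norm_star, norm_sub_rev, mul_comm]
  calc ‖(1 - P) * X * star P + X * (1 - star P)‖ ≤ ‖(1 - P) * X * star P‖ + ‖X * (1 - star P)‖ := norm_add_le _ _
    _ ≤ ‖P - 1‖ * ‖X‖ + ‖P - 1‖ * ‖X‖ := add_le_add h1 h2
    _ = 2 * ‖P - 1‖ * ‖X‖ := by ring

omit [DecidableEq n] in
/-- The four-term expression `Z₁ + U·Z₂·U^* − Q·Z₃·Q^* − P₀·Z₄·P₀^*` is `ℂ`-homogeneous in `(Z₁, Z₂, Z₃, Z₄)`. [folklore] -/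
theorem smul_linPart (c : ℂ) (U Q P₀ Z₁ Z₂ Z₃ Z₄ : Matrix n n ℂ) :
    c • Z₁ + U * (c • Z₂) * star U - Q * (c • Z₃) * star Q - P₀ * (c • Z₄) * star P₀
      = c • (Z₁ + U * Z₂ * star U - Q * Z₃ * star Q - P₀ * Z₄ * star P₀) := by
  simp only [Matrix.mul_smul, Matrix.smul_mul, smul_add, smul_sub]

end Algebra

/-! ## §2 On the lattice: the door's `ℒ_p` of a gauge direction, per plaquette -/

section Lattice

variable {P : Params} {i : ℕ} {N : ℕ} [NeZero N]

omit [NeZero N] in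
/-- Unit shifts in two directions commute on the torus (tree: `BlockAveragingEMLProp2.shift_shift_comm`). [folklore] -/
private theorem shift_shift_comm' (y : Site P i) (μ ν : Fin P.d) : (y.shift μ).shift ν = (y.shift ν).shift μ := by
  funext κ
  by_cases hκν : κ = ν
  · subst hκν
    by_cases hκμ : κ = μ
    · subst hκμ; rfl
    · simp [Site.shift, Function.update_apply, hκμ]
  · by_cases hκμ : κ = μ
    · subst hκμ
      simp [Site.shift, Function.update_apply, hκν]
    · simp [Site.shift, Function.update_apply, hκν, hκμ]

omit [NeZero N] in
/-- **THE GAUGE DIRECTION IN THE B9 LETTERS OF THE S4 ROWS**: `Z^λ_{(z,κ)} = λ(z) − W_{(z,κ)}·λ(z + e_κ)·W_{(z,κ)}^* = −(D_{W,κ}λ)(z)` for the covariant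
derivative `covD (torusT P i) (unitsField (toUField W))` of ✓ `B9Eq39Adjoint` (so `δ = D_W log u` there is `−Z^{log u}`; `K_W` is even).
[cite: Balaban1985BackgroundPropagators, (3.3) p.390] -/
theorem gaugeDir_eq_neg_covD (W : GaugeField P i (Matrix.specialUnitaryGroup (Fin N) ℂ)) (lam : Site P i → Matrix (Fin N) (Fin N) ℂ)
    (κ : Fin P.d) (z : Site P i) :
    lam z - (W ⟨z, κ⟩ : Matrix (Fin N) (Fin N) ℂ) * lam (z.shift κ) * star (W ⟨z, κ⟩ : Matrix (Fin N) (Fin N) ℂ)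
      = -covD (torusT P i) (fun κ z => unitsField (toUField W) ⟨z, κ⟩) κ lam z := by
  rw [covD, B9Eq39Adjoint.R_def, torusT_apply, neg_sub]
  rfl

/-- ★ **THE DOOR's `ℒ_p` TELESCOPES ON A GAUGE DIRECTION.**  For any background `W : GaugeField P i SU(N)`, any site field `λ`, and the bond field
`Z^λ_b = λ(b.src) − W_b·λ(b.src + e_{b.dir})·W_b^*`: the four-term linearised plaquette of the (α′) knit (its letters VERBATIM) at `D := Z^λ` equals
`i·(λ(x) − W(∂p)·λ(x)·W(∂p)^*)`, `x = p.src` (✓ `Prop7LinGaugeInvariance.linPart_gaugeDir_eq`: the corners `x+e_μ`, `x+e_ν`, `x+e_μ+e_ν` cancel pairwise).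
[cite: Balaban1985BackgroundPropagators, (3.4) p.391, (3.9)-(3.11) p.392] -/
theorem linPlaq_gaugeDir_eq (W : GaugeField P i (Matrix.specialUnitaryGroup (Fin N) ℂ)) (lam : Site P i → Matrix (Fin N) (Fin N) ℂ)
    (Z : PBond P i → Matrix (Fin N) (Fin N) ℂ)
    (hZ : ∀ b : PBond P i, Z b = lam b.src - (W b : Matrix (Fin N) (Fin N) ℂ) * lam (b.src.shift b.dir) * star (W b : Matrix (Fin N) (Fin N) ℂ))
    (p : Plaq P i) :
    (Complex.I • Z ⟨p.src, p.μ⟩)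
        + ((W ⟨p.src, p.μ⟩ : Matrix (Fin N) (Fin N) ℂ) * (Complex.I • Z ⟨p.src.shift p.μ, p.ν⟩) * star (W ⟨p.src, p.μ⟩ : Matrix (Fin N) (Fin N) ℂ))
        - (((W ⟨p.src, p.μ⟩ * W ⟨p.src.shift p.μ, p.ν⟩ * (W ⟨p.src.shift p.ν, p.μ⟩)⁻¹ : Matrix.specialUnitaryGroup (Fin N) ℂ) : Matrix (Fin N) (Fin N) ℂ)
            * (Complex.I • Z ⟨p.src.shift p.ν, p.μ⟩)
            * star ((W ⟨p.src, p.μ⟩ * W ⟨p.src.shift p.μ, p.ν⟩ * (W ⟨p.src.shift p.ν, p.μ⟩)⁻¹ : Matrix.specialUnitaryGroup (Fin N) ℂ) : Matrix (Fin N) (Fin N) ℂ))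
        - (((GaugeField.plaqHol W p : Matrix.specialUnitaryGroup (Fin N) ℂ) : Matrix (Fin N) (Fin N) ℂ) * (Complex.I • Z ⟨p.src, p.ν⟩)
            * star ((GaugeField.plaqHol W p : Matrix.specialUnitaryGroup (Fin N) ℂ) : Matrix (Fin N) (Fin N) ℂ))
      = Complex.I • (lam p.src - ((GaugeField.plaqHol W p : Matrix.specialUnitaryGroup (Fin N) ℂ) : Matrix (Fin N) (Fin N) ℂ) * lam p.src
            * star ((GaugeField.plaqHol W p : Matrix.specialUnitaryGroup (Fin N) ℂ) : Matrix (Fin N) (Fin N) ℂ)) := by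
  rw [smul_linPart, hZ, hZ, hZ, hZ]
  congr 1
  simp only
  rw [shift_shift_comm' p.src p.ν p.μ, plaqHol_eq_word W p]
  exact linPart_gaugeDir_eq (W ⟨p.src, p.μ⟩) (W ⟨p.src.shift p.μ, p.ν⟩) (W ⟨p.src.shift p.ν, p.μ⟩) (W ⟨p.src, p.ν⟩)
    (lam p.src) (lam (p.src.shift p.μ)) (lam (p.src.shift p.ν)) (lam ((p.src.shift p.μ).shift p.ν))

/-- ★ **POINTWISE: `‖ℒ_p(i·Z^λ)‖ ≤ 2·‖W(∂p) − 1‖·‖λ(p.src)‖`** (telescoping + `‖X − PXP^*‖ ≤ 2‖P − 1‖‖X‖`).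
[cite: Balaban1985BackgroundPropagators, (3.4) p.391] [cite: Balaban1985Averaging, (19)-(21) p.21] -/
theorem norm_linPlaq_gaugeDir_le (W : GaugeField P i (Matrix.specialUnitaryGroup (Fin N) ℂ)) (lam : Site P i → Matrix (Fin N) (Fin N) ℂ)
    (Z : PBond P i → Matrix (Fin N) (Fin N) ℂ)
    (hZ : ∀ b : PBond P i, Z b = lam b.src - (W b : Matrix (Fin N) (Fin N) ℂ) * lam (b.src.shift b.dir) * star (W b : Matrix (Fin N) (Fin N) ℂ))
    (p : Plaq P i) :
    ‖(Complex.I • Z ⟨p.src, p.μ⟩)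
        + ((W ⟨p.src, p.μ⟩ : Matrix (Fin N) (Fin N) ℂ) * (Complex.I • Z ⟨p.src.shift p.μ, p.ν⟩) * star (W ⟨p.src, p.μ⟩ : Matrix (Fin N) (Fin N) ℂ))
        - (((W ⟨p.src, p.μ⟩ * W ⟨p.src.shift p.μ, p.ν⟩ * (W ⟨p.src.shift p.ν, p.μ⟩)⁻¹ : Matrix.specialUnitaryGroup (Fin N) ℂ) : Matrix (Fin N) (Fin N) ℂ)
            * (Complex.I • Z ⟨p.src.shift p.ν, p.μ⟩)
            * star ((W ⟨p.src, p.μ⟩ * W ⟨p.src.shift p.μ, p.ν⟩ * (W ⟨p.src.shift p.ν, p.μ⟩)⁻¹ : Matrix.specialUnitaryGroup (Fin N) ℂ) : Matrix (Fin N) (Fin N) ℂ))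
        - (((GaugeField.plaqHol W p : Matrix.specialUnitaryGroup (Fin N) ℂ) : Matrix (Fin N) (Fin N) ℂ) * (Complex.I • Z ⟨p.src, p.ν⟩)
            * star ((GaugeField.plaqHol W p : Matrix.specialUnitaryGroup (Fin N) ℂ) : Matrix (Fin N) (Fin N) ℂ))‖
      ≤ 2 * ‖((GaugeField.plaqHol W p : Matrix.specialUnitaryGroup (Fin N) ℂ) : Matrix (Fin N) (Fin N) ℂ) - 1‖ * ‖lam p.src‖ := by
  rw [linPlaq_gaugeDir_eq W lam Z hZ p, norm_smul, Complex.norm_I, one_mul]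
  exact norm_sub_conj_le (GaugeField.plaqHol W p).2.1 (lam p.src)

end Lattice

/-! ## §3 Summed: the `[F,ψ]` booking -/

section Booked

variable {P : Params} {i : ℕ} {N : ℕ} [NeZero N]

/-- ★★ **`K_W(Z^λ) ≤ 4·Σ_p ‖W(∂p) − 1‖²·‖λ(p.src)‖²`** — the door's linearised-curvature energy of an infinitesimal gauge direction is the energy
of the commutators with the plaquette variables (any background, any site field; no pinning, no smallness).
[cite: Balaban1985Variational, (47)-(48) pp.285-286] [cite: Balaban1985BackgroundPropagators, (3.4) p.391] -/
theorem plaqK_gaugeDir_le (W : GaugeField P i (Matrix.specialUnitaryGroup (Fin N) ℂ)) (lam : Site P i → Matrix (Fin N) (Fin N) ℂ)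
    (Z : PBond P i → Matrix (Fin N) (Fin N) ℂ)
    (hZ : ∀ b : PBond P i, Z b = lam b.src - (W b : Matrix (Fin N) (Fin N) ℂ) * lam (b.src.shift b.dir) * star (W b : Matrix (Fin N) (Fin N) ℂ)) :
    (∑ p : Plaq P i, ‖((Complex.I • Z ⟨p.src, p.μ⟩)
          + ((W ⟨p.src, p.μ⟩ : Matrix (Fin N) (Fin N) ℂ) * (Complex.I • Z ⟨p.src.shift p.μ, p.ν⟩) * star (W ⟨p.src, p.μ⟩ : Matrix (Fin N) (Fin N) ℂ))
          - (((W ⟨p.src, p.μ⟩ * W ⟨p.src.shift p.μ, p.ν⟩ * (W ⟨p.src.shift p.ν, p.μ⟩)⁻¹ : Matrix.specialUnitaryGroup (Fin N) ℂ) : Matrix (Fin N) (Fin N) ℂ)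
              * (Complex.I • Z ⟨p.src.shift p.ν, p.μ⟩)
              * star ((W ⟨p.src, p.μ⟩ * W ⟨p.src.shift p.μ, p.ν⟩ * (W ⟨p.src.shift p.ν, p.μ⟩)⁻¹ : Matrix.specialUnitaryGroup (Fin N) ℂ) : Matrix (Fin N) (Fin N) ℂ))
          - (((GaugeField.plaqHol W p : Matrix.specialUnitaryGroup (Fin N) ℂ) : Matrix (Fin N) (Fin N) ℂ) * (Complex.I • Z ⟨p.src, p.ν⟩)
              * star ((GaugeField.plaqHol W p : Matrix.specialUnitaryGroup (Fin N) ℂ) : Matrix (Fin N) (Fin N) ℂ)))‖ ^ 2)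
      ≤ 4 * ∑ p : Plaq P i, ‖((GaugeField.plaqHol W p : Matrix.specialUnitaryGroup (Fin N) ℂ) : Matrix (Fin N) (Fin N) ℂ) - 1‖ ^ 2 * ‖lam p.src‖ ^ 2 := by
  rw [Finset.mul_sum]
  refine Finset.sum_le_sum fun p _ => ?_
  have h := norm_linPlaq_gaugeDir_le W lam Z hZ p
  have h0 := norm_nonneg ((Complex.I • Z ⟨p.src, p.μ⟩)
          + ((W ⟨p.src, p.μ⟩ : Matrix (Fin N) (Fin N) ℂ) * (Complex.I • Z ⟨p.src.shift p.μ, p.ν⟩) * star (W ⟨p.src, p.μ⟩ : Matrix (Fin N) (Fin N) ℂ))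
          - (((W ⟨p.src, p.μ⟩ * W ⟨p.src.shift p.μ, p.ν⟩ * (W ⟨p.src.shift p.ν, p.μ⟩)⁻¹ : Matrix.specialUnitaryGroup (Fin N) ℂ) : Matrix (Fin N) (Fin N) ℂ)
              * (Complex.I • Z ⟨p.src.shift p.ν, p.μ⟩)
              * star ((W ⟨p.src, p.μ⟩ * W ⟨p.src.shift p.μ, p.ν⟩ * (W ⟨p.src.shift p.ν, p.μ⟩)⁻¹ : Matrix.specialUnitaryGroup (Fin N) ℂ) : Matrix (Fin N) (Fin N) ℂ))
          - (((GaugeField.plaqHol W p : Matrix.specialUnitaryGroup (Fin N) ℂ) : Matrix (Fin N) (Fin N) ℂ) * (Complex.I • Z ⟨p.src, p.ν⟩)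
              * star ((GaugeField.plaqHol W p : Matrix.specialUnitaryGroup (Fin N) ℂ) : Matrix (Fin N) (Fin N) ℂ)))
  have hsq := pow_le_pow_left₀ h0 h 2
  nlinarith [hsq]

/-- ★★★ **THE `[F,ψ]` BOOKING UNDER THE PLAQUETTE CLAUSE**: if `dist1(W(∂p)) ≤ a` on every plaquette (e.g. `W ∈ (6)(e)`: `a = e·L^{−2(K−n)}`), then
`K_W(Z^λ) ≤ 4a²·Σ_p ‖λ(p.src)‖²`. [cite: Balaban1985Variational, (6) p.278, (47)-(48) pp.285-286] -/
theorem plaqK_gaugeDir_le_of_dist1_le (W : GaugeField P i (Matrix.specialUnitaryGroup (Fin N) ℂ)) {a : ℝ}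
    (hW : ∀ p : Plaq P i, dist1 (GaugeField.plaqHol W p) ≤ a) (lam : Site P i → Matrix (Fin N) (Fin N) ℂ)
    (Z : PBond P i → Matrix (Fin N) (Fin N) ℂ)
    (hZ : ∀ b : PBond P i, Z b = lam b.src - (W b : Matrix (Fin N) (Fin N) ℂ) * lam (b.src.shift b.dir) * star (W b : Matrix (Fin N) (Fin N) ℂ)) :
    (∑ p : Plaq P i, ‖((Complex.I • Z ⟨p.src, p.μ⟩)
          + ((W ⟨p.src, p.μ⟩ : Matrix (Fin N) (Fin N) ℂ) * (Complex.I • Z ⟨p.src.shift p.μ, p.ν⟩) * star (W ⟨p.src, p.μ⟩ : Matrix (Fin N) (Fin N) ℂ))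
          - (((W ⟨p.src, p.μ⟩ * W ⟨p.src.shift p.μ, p.ν⟩ * (W ⟨p.src.shift p.ν, p.μ⟩)⁻¹ : Matrix.specialUnitaryGroup (Fin N) ℂ) : Matrix (Fin N) (Fin N) ℂ)
              * (Complex.I • Z ⟨p.src.shift p.ν, p.μ⟩)
              * star ((W ⟨p.src, p.μ⟩ * W ⟨p.src.shift p.μ, p.ν⟩ * (W ⟨p.src.shift p.ν, p.μ⟩)⁻¹ : Matrix.specialUnitaryGroup (Fin N) ℂ) : Matrix (Fin N) (Fin N) ℂ))
          - (((GaugeField.plaqHol W p : Matrix.specialUnitaryGroup (Fin N) ℂ) : Matrix (Fin N) (Fin N) ℂ) * (Complex.I • Z ⟨p.src, p.ν⟩)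
              * star ((GaugeField.plaqHol W p : Matrix.specialUnitaryGroup (Fin N) ℂ) : Matrix (Fin N) (Fin N) ℂ)))‖ ^ 2)
      ≤ 4 * a ^ 2 * ∑ p : Plaq P i, ‖lam p.src‖ ^ 2 := by
  refine (plaqK_gaugeDir_le W lam Z hZ).trans ?_
  rw [mul_assoc, Finset.mul_sum, Finset.mul_sum, Finset.mul_sum]
  refine Finset.sum_le_sum fun p _ => ?_
  have hd : ‖((GaugeField.plaqHol W p : Matrix.specialUnitaryGroup (Fin N) ℂ) : Matrix (Fin N) (Fin N) ℂ) - 1‖ ≤ a := hW p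
  have hd0 : 0 ≤ ‖((GaugeField.plaqHol W p : Matrix.specialUnitaryGroup (Fin N) ℂ) : Matrix (Fin N) (Fin N) ℂ) - 1‖ := norm_nonneg _
  have hsq : ‖((GaugeField.plaqHol W p : Matrix.specialUnitaryGroup (Fin N) ℂ) : Matrix (Fin N) (Fin N) ℂ) - 1‖ ^ 2 ≤ a ^ 2 :=
    pow_le_pow_left₀ hd0 hd 2
  have hl : 0 ≤ ‖lam p.src‖ ^ 2 := sq_nonneg _
  nlinarith [mul_le_mul_of_nonneg_right hsq hl]

omit [NeZero N] in
/-- Plaquettes per source site: `Σ_p ‖λ(p.src)‖² ≤ d²·Σ_x ‖λ(x)‖²` (a plaquette is determined by `(src, μ, ν)`). [folklore] -/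
theorem sum_plaq_normSq_src_le (lam : Site P i → Matrix (Fin N) (Fin N) ℂ) :
    ∑ p : Plaq P i, ‖lam p.src‖ ^ 2 ≤ (P.d : ℝ) ^ 2 * ∑ x : Site P i, ‖lam x‖ ^ 2 := by
  have h := sum_plaq_le_sum_site_dir (P := P) (i := i) (fun x _ _ => ‖lam x‖ ^ 2) (fun _ _ _ => sq_nonneg _)
  refine h.trans (le_of_eq ?_)
  rw [Finset.mul_sum]
  refine Finset.sum_congr rfl fun x _ => ?_
  simp only [Finset.sum_const, Finset.card_univ, Fintype.card_fin]
  ring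

/-- ★★★ **THE `[F,ψ]` BOOKING AGAINST THE SITE MASS**: under `dist1(W(∂p)) ≤ a`, `K_W(Z^λ) ≤ 4a²·d²·Σ_x ‖λ(x)‖²` — with the pinned Poincaré of the
corrector (`Σ_x‖ψ‖² ≤ C_P·ℓ²·Σ_b‖Z^ψ_b‖²`, `ψ|_C = 0`) a `θ·ℓ⁻²·Σ_b‖Z^ψ_b‖²` entry with `θ = 4d²C_P·a²ℓ⁴ = 4d²C_P·e²` at `a = eℓ⁻²`, no volume factor.
[cite: Balaban1985Variational, (6) p.278, (47)-(48) pp.285-286, (141)-(143) p.299] -/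
theorem plaqK_gaugeDir_le_sites (W : GaugeField P i (Matrix.specialUnitaryGroup (Fin N) ℂ)) {a : ℝ}
    (hW : ∀ p : Plaq P i, dist1 (GaugeField.plaqHol W p) ≤ a) (lam : Site P i → Matrix (Fin N) (Fin N) ℂ)
    (Z : PBond P i → Matrix (Fin N) (Fin N) ℂ)
    (hZ : ∀ b : PBond P i, Z b = lam b.src - (W b : Matrix (Fin N) (Fin N) ℂ) * lam (b.src.shift b.dir) * star (W b : Matrix (Fin N) (Fin N) ℂ)) :
    (∑ p : Plaq P i, ‖((Complex.I • Z ⟨p.src, p.μ⟩)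
          + ((W ⟨p.src, p.μ⟩ : Matrix (Fin N) (Fin N) ℂ) * (Complex.I • Z ⟨p.src.shift p.μ, p.ν⟩) * star (W ⟨p.src, p.μ⟩ : Matrix (Fin N) (Fin N) ℂ))
          - (((W ⟨p.src, p.μ⟩ * W ⟨p.src.shift p.μ, p.ν⟩ * (W ⟨p.src.shift p.ν, p.μ⟩)⁻¹ : Matrix.specialUnitaryGroup (Fin N) ℂ) : Matrix (Fin N) (Fin N) ℂ)
              * (Complex.I • Z ⟨p.src.shift p.ν, p.μ⟩)
              * star ((W ⟨p.src, p.μ⟩ * W ⟨p.src.shift p.μ, p.ν⟩ * (W ⟨p.src.shift p.ν, p.μ⟩)⁻¹ : Matrix.specialUnitaryGroup (Fin N) ℂ) : Matrix (Fin N) (Fin N) ℂ))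
          - (((GaugeField.plaqHol W p : Matrix.specialUnitaryGroup (Fin N) ℂ) : Matrix (Fin N) (Fin N) ℂ) * (Complex.I • Z ⟨p.src, p.ν⟩)
              * star ((GaugeField.plaqHol W p : Matrix.specialUnitaryGroup (Fin N) ℂ) : Matrix (Fin N) (Fin N) ℂ)))‖ ^ 2)
      ≤ 4 * a ^ 2 * ((P.d : ℝ) ^ 2 * ∑ x : Site P i, ‖lam x‖ ^ 2) :=
  (plaqK_gaugeDir_le_of_dist1_le W hW lam Z hZ).trans
    (mul_le_mul_of_nonneg_left (sum_plaq_normSq_src_le lam) (by positivity))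

end Booked

end Summit.QuantumFields.YangMills.Theorems.Prop7GaugeDirPlaqK

end
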